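import Literature.Probability.LatticeModels.MagnetizationExponentUpperProofs
import HarnessLib

/-!
# Route `SynchronousCoupling`, crux `UniformRegularity` (item stmt-CriticalPhenomena-4658), line `Sketch`
# (magnetic ruler): registered stub `stub_magnetizationRegular`

Regularity of the "ruler" of the line, the critical isotherm of the nearest-neighbour Ising model on `ℤ³`,
`M(h) := magnetizationInField 3 (criticalBeta 3) h = ⟨σ₀⟩⁺_{β_c,h}`:

* `M` is continuous on `(0, ∞)` — at each `h₀ > 0`, right-continuity of the plus state in the field
  (tree theorem `plusCorr_continuousWithinAt_Ici_field`, Friedli–Velenik 2017, Lemma 3.31 (1)) and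
  left-continuity from the GHS concavity bound `⟨σ₀⟩⁺_{β,h₀} - ⟨σ₀⟩⁺_{β,h₀-δ} ≤ δ/h₀` (tree theorem
  `plusCorr_sub_plusCorr_sub_le`, Friedli–Velenik 2017, Remark 3.41: "the magnetization `h ↦ ⟨σ₀⟩⁺_{β,h}`
  is concave, and hence continuous, on `ℝ_{≥0}`") together with GKS monotonicity (`plusCorr_mono_params`);
* `M(h) → 0` as `h ↓ 0` — `⟨σ₀⟩⁺_{β,h} → m*(β)` (`magnetizationInField_tendsto_spontaneousMagnetization`)
  and `m*(β_c) = 0` on `ℤ³` (`spontaneousMagnetization_criticalBeta_eq_zero_holds`,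
  Aizenman–Duminil-Copin–Sidoravicius 2015);
* `M(h) > 0` for `h > 0` — `⟨σ₀⟩⁺_{β_c,h} ≥ ⟨σ₀⟩^∅_{β_c,h} ≥ tanh(β_c h) > 0` (GKS: `freeCorr_le_plusCorr`,
  `dctMagInf_pos`; `β_c(3) > 0` by `criticalBeta_pos_holds`).

Helper file (`--supports`); the composition lives in the lead's skeleton. No definition, no notation.
-/

noncomputable section

namespace Summit.CriticalPhenomena.Ising3DConformalLimit.Theorems.MagneticRuler

open Filter Topology
open Literature.Probability.LatticeModels

/-- **Left-continuity of `h ↦ ⟨σ₀⟩⁺_{β,h}` at every `h₀ > 0`** (`β ≥ 0`): for `0 < h ≤ h₀`,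
`0 ≤ ⟨σ₀⟩⁺_{β,h₀} - ⟨σ₀⟩⁺_{β,h} ≤ (h₀ - h)/h₀` by GKS monotonicity and the GHS concavity bound
`plusCorr_sub_plusCorr_sub_le` (Friedli–Velenik 2017, Remark 3.41: concave, hence continuous, on
`ℝ_{≥0}`). [cite: FriedliVelenik2017, Remark 3.41 (held text p. 133) and Lemma 3.31 (1), p. 119] -/
theorem plusCorr_singleton_continuousWithinAt_Iic_field {d : ℕ} {β : ℝ} (hβ : 0 ≤ β) {h₀ : ℝ}
    (hh₀ : 0 < h₀) : ContinuousWithinAt (fun h => plusCorr d β h {0}) (Set.Iic h₀) h₀ := by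
  rw [Metric.continuousWithinAt_iff]
  intro ε hε
  have hεh : 0 < ε * h₀ := mul_pos hε hh₀
  refine ⟨min h₀ (ε * h₀ / 2), lt_min hh₀ (by positivity), fun h hh hdist => ?_⟩
  have hhh₀ : h ≤ h₀ := hh
  rw [Real.dist_eq, abs_lt] at hdist
  have hmin₁ := min_le_left h₀ (ε * h₀ / 2)
  have hmin₂ := min_le_right h₀ (ε * h₀ / 2)
  have hpos : 0 < h := by linarith [hdist.1]
  rw [Real.dist_eq, abs_lt]
  rcases hhh₀.eq_or_lt with rfl | hlt
  · constructor <;> linarith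
  · have hδ : 0 < h₀ - h := sub_pos.2 hlt
    have h1 : plusCorr d β h {0} ≤ plusCorr d β h₀ {0} :=
      plusCorr_mono_params hβ le_rfl hpos.le hhh₀ {0}
    have h2 := plusCorr_sub_plusCorr_sub_le (d := d) hβ hδ (by linarith : h₀ - h ≤ h₀)
    rw [sub_sub_cancel] at h2
    have h3 : (h₀ - h) / h₀ < ε := by
      rw [div_lt_iff₀ hh₀]
      linarith [hdist.1]
    constructor <;> linarith

/-- **Continuity of `h ↦ m(β,h) = ⟨σ₀⟩⁺_{β,h}` at every `h₀ > 0`** (`β ≥ 0`): right-continuity of the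
plus state in the field (`plusCorr_continuousWithinAt_Ici_field`, Friedli–Velenik 2017, Lemma 3.31 (1))
and left-continuity (`plusCorr_singleton_continuousWithinAt_Iic_field`, Remark 3.41). [cite: FriedliVelenik2017, Lemma 3.31 (1), p. 119, and Remark 3.41] -/
theorem magnetizationInField_continuousAt_field {d : ℕ} {β : ℝ} (hβ : 0 ≤ β) {h₀ : ℝ}
    (hh₀ : 0 < h₀) : ContinuousAt (fun h => magnetizationInField d β h) h₀ := by
  have hfun : (fun h => magnetizationInField d β h) = fun h => plusCorr d β h {0} :=
    funext fun h => magnetizationInField_eq_plusCorr β h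
  rw [hfun, continuousAt_iff_continuous_left_right]
  exact ⟨plusCorr_singleton_continuousWithinAt_Iic_field hβ hh₀,
    plusCorr_continuousWithinAt_Ici_field hβ {0} hh₀.le⟩

/-- **Positivity of the magnetisation in a positive field**: `0 < m(β,h)` for `β > 0`, `h > 0`, since
`⟨σ₀⟩⁺_{β,h} ≥ ⟨σ₀⟩^∅_{β,h} ≥ tanh(βh) > 0` (GKS comparison of boundary conditions and of volumes down
to the single site; Friedli–Velenik 2017, Exercises 3.12 and 3.25). [cite: FriedliVelenik2017, Exercise 3.12, p. 112, and Exercise 3.25, p. 132] -/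
theorem magnetizationInField_pos {d : ℕ} {β h : ℝ} (hβ : 0 < β) (hh : 0 < h) :
    0 < magnetizationInField d β h := by
  rw [magnetizationInField_eq_plusCorr]
  refine lt_of_lt_of_le ?_ (freeCorr_le_plusCorr hβ.le hh.le {0})
  have := dctMagInf_pos (d := d) hβ (mul_pos hβ hh)
  rwa [dctMagInf, mul_div_cancel_left₀ _ hβ.ne'] at this

/-- **Registered stub `stub_magnetizationRegular` of line `Sketch` (magnetic ruler), proved.** The critical
isotherm `h ↦ M(h) = ⟨σ₀⟩⁺_{β_c,h}` of the nearest-neighbour Ising model on `ℤ³` is continuous on `(0,∞)`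
(Friedli–Velenik 2017, Lemma 3.31 (1) and Remark 3.41), tends to `m*(β_c) = 0` as `h ↓ 0`
(Aizenman–Duminil-Copin–Sidoravicius 2015, Thm. 1.2 with Cor. 1.5 (1)), and is positive for `h > 0`
(GKS, `β_c(3) > 0`). [cite: FriedliVelenik2017, Lemma 3.31 (1), p. 119, and Remark 3.41] [cite: AizenmanDuminilCopinSidoraviciusCMP2015, Thm. 1.2 with Cor. 1.5 (1)] -/
theorem stub_magnetizationRegular : ContinuousOn (fun h : ℝ => Literature.Probability.LatticeModels.magnetizationInField 3 (Literature.Probability.LatticeModels.criticalBeta 3) h) (Set.Ioi 0) ∧ Filter.Tendsto (fun h : ℝ => Literature.Probability.LatticeModels.magnetizationInField 3 (Literature.Probability.LatticeModels.criticalBeta 3) h) (nhdsWithin 0 (Set.Ioi 0)) (nhds 0) ∧ ∀ h : ℝ, 0 < h → 0 < Literature.Probability.LatticeModels.magnetizationInField 3 (Literature.Probability.LatticeModels.criticalBeta 3) h := by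
  have hβ : 0 < criticalBeta 3 := criticalBeta_pos_holds (d := 3) (by norm_num)
  refine ⟨fun h₀ hh₀ => (magnetizationInField_continuousAt_field hβ.le hh₀).continuousWithinAt, ?_,
    fun h hh => magnetizationInField_pos hβ hh⟩
  have ht := magnetizationInField_tendsto_spontaneousMagnetization (d := 3) hβ.le
  rwa [spontaneousMagnetization_criticalBeta_eq_zero_holds (d := 3) (by norm_num)] at ht

end Summit.CriticalPhenomena.Ising3DConformalLimit.Theorems.MagneticRuler
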